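import Summits.Ventures.Crystal3D.Theorems.StickyWulffConstantCoaxialWallLawKissingCageLocal
import Summits.Ventures.Crystal3D.Theorems.StickyWulffConstantGenericWallFloorTwinFrame
import HarnessLib

/-!
# Foreign contacts at a framed host touch AT MOST TWO frame balls; two only at the 24 FACE-TWIN positions
# (crux `CoaxialWallLaw`, stmt-Ventures-19481, line `WallLedgerF`; census-free brick T2 for the OFF-MODULE tail)

HONEST FRAMING. Venture `Summits/Ventures/Crystal3D` (cell `crystal3d-full`), helper `--supports` the crux
`CoaxialWallLaw` (stmt-Ventures-19481, `route-Ventures-StickyWulffConstant`), REGISTERED line `WallLedgerF` (planner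
cf-p1).  Rung credit; F-C1 not moved; census-free.  cf-p1 DECISION (lxxiv)(4) (2026-08-29T00:54:38Z): «T2 GO now (lens
geometry `foreign_ball_lens` …)»; memo HOME/wall-19481-p2/F-TAIL-g8.md §6 (T2).  Continues `…KissingCageLocal`
(`foreign_contact_adjacent_divacancy`: an off-frame contact `x` of a host `y` blocks an ADJACENT vacant slot pair).

THE LENS GEOMETRY, as exact statements about a unit vector `t = x − y` read against a frame `G` (slot dozen
`G·fccSlots`; CONTACT slot `w`: `⟪t, G w⟫ = ½`, i.e. `dist x (y + G w) = 1`; BLOCKED slot: `⟪t, G w⟫ > ½`):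
* `inner_slots_nonneg_of_blocked` — two slots both STRICTLY within `60°` of `t` are at inner product `≥ 0` (the blocked
  set is pairwise non-obtuse: an edge, a path or the whole of a square face, or a triangular face);
  `inner_slots_nonneg_of_blocked_of_contact` — the same for a blocked slot and a contact slot;
* `two_contacts_core` / **`eq_frame_or_faceTwin_of_two_contacts`** — if `t` has TWO distinct contact slots `a ≠ b`
  then EITHER `t` is itself a slot reading (`t = G w`), OR `a, b` are adjacent, and with `c` the third slot of their
  triangle `t = G (⅔(a + b) − c)`: the reflection of the reading `G c` through the face `{0, G a, G b}` of the
  tetrahedral cell `{0, G a, G b, G c}` — one of the `24` FACE-TWIN positions; there `t` blocks exactly the adjacent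
  pair `a − c, b − c` (`inner_faceTwin_sub`);
* `three_contacts_core` / **`eq_frame_of_three_contacts`**, **`card_contactSlots_le_two`** — THREE contact slots
  force `t` onto the frame; so an OFF-FRAME unit vector has at most two contact slots;
* configuration level: **`foreign_contact_frame_contacts_le_two`** — in a `1`-separated `X`, a ball `x ∈ X` touching
  `y` off the frame `y + G·fccSlots` touches at most two frame balls `y + G w ∈ X`; **`foreign_contact_faceTwin`** — if
  it touches two, `x = y + G(⅔(a + b) − c)` for a slot triangle `{a, b, c}` and the two sites `y + G (a − c)`,
  `y + G (b − c)` are vacant.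
READING (for T3): a foreign ball with three or more contacts in a single host cluster `{y} ∪ (y + G·fccSlots)` sits at one
of `24` face-twin positions; every other foreign contact of `y` touches at most one further frame ball of `y`.
WHAT THIS IS NOT: not the tail; F-C1 not moved.
-/

noncomputable section

namespace Summit.Ventures.Crystal3D.Theorems

open Summit.Ventures.Crystal3D Finset NearIdentity
open scoped InnerProductSpace

/-! ### Blocked slots are pairwise non-obtuse -/

/-- If the unit vector `t` is at inner product `> ½` with `G v` and `≥ ½` with `G n` (`v, n` slots), then
`⟪v, n⟫ ≥ 0`.  (`⟪t, G v + G n⟫ > 1` forces `‖G v + G n‖ > 1`, i.e. `⟪v, n⟫ > −½`; slot inner products are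
half-integers.) -/
theorem inner_slots_nonneg_of_inner_gt_ge (G : EuclideanSpace ℝ (Fin 3) ≃ₗᵢ[ℝ] EuclideanSpace ℝ (Fin 3))
    {v n t : EuclideanSpace ℝ (Fin 3)} (hv : v ∈ fccSlots) (hn : n ∈ fccSlots) (ht : ‖t‖ = 1)
    (htv : 1 / 2 < ⟪t, G v⟫_ℝ) (htn : 1 / 2 ≤ ⟪t, G n⟫_ℝ) : 0 ≤ ⟪v, n⟫_ℝ := by
  obtain ⟨k, rfl⟩ := exists_slotSite_eq hv
  obtain ⟨l, rfl⟩ := exists_slotSite_eq hn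
  have hGv : ‖G (slotSite k)‖ = 1 := by rw [LinearIsometryEquiv.norm_map, norm_eq_one_of_mem_fccSlots hv]
  have hGn : ‖G (slotSite l)‖ = 1 := by rw [LinearIsometryEquiv.norm_map, norm_eq_one_of_mem_fccSlots hn]
  set u := G (slotSite k) + G (slotSite l) with hu
  have hsum : 1 < ⟪t, u⟫_ℝ := by rw [hu, inner_add_right]; linarith
  have hcs := real_inner_le_norm t u
  rw [ht, one_mul] at hcs
  have hu1 : 1 < ‖u‖ := lt_of_lt_of_le hsum hcs
  have husq : ‖u‖ ^ 2 = 2 + 2 * ⟪slotSite k, slotSite l⟫_ℝ := by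
    rw [hu, norm_add_sq_real, hGv, hGn, LinearIsometryEquiv.inner_map_map]; ring
  have hreal : -(1 / 2 : ℝ) < ⟪slotSite k, slotSite l⟫_ℝ := by nlinarith [hu1, husq, norm_nonneg u]
  rw [inner_slotSite] at hreal ⊢
  have hint : (-1 : ℤ) < slotInt k ⬝ᵥ slotInt l := by
    have : (-1 : ℝ) < ((slotInt k ⬝ᵥ slotInt l : ℤ) : ℝ) := by linarith
    exact_mod_cast this
  have : (0 : ℝ) ≤ ((slotInt k ⬝ᵥ slotInt l : ℤ) : ℝ) := by exact_mod_cast (by omega : (0 : ℤ) ≤ slotInt k ⬝ᵥ slotInt l)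
  linarith

/-- **Blocked slots are pairwise non-obtuse**: two slots both strictly within `60°` of a unit vector meet at `≥ 0`. -/
theorem inner_slots_nonneg_of_blocked (G : EuclideanSpace ℝ (Fin 3) ≃ₗᵢ[ℝ] EuclideanSpace ℝ (Fin 3))
    {v n t : EuclideanSpace ℝ (Fin 3)} (hv : v ∈ fccSlots) (hn : n ∈ fccSlots) (ht : ‖t‖ = 1)
    (htv : 1 / 2 < ⟪t, G v⟫_ℝ) (htn : 1 / 2 < ⟪t, G n⟫_ℝ) : 0 ≤ ⟪v, n⟫_ℝ :=
  inner_slots_nonneg_of_inner_gt_ge G hv hn ht htv htn.le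

/-- A blocked slot and a contact slot are at inner product `≥ 0`. -/
theorem inner_slots_nonneg_of_blocked_of_contact (G : EuclideanSpace ℝ (Fin 3) ≃ₗᵢ[ℝ] EuclideanSpace ℝ (Fin 3))
    {v w t : EuclideanSpace ℝ (Fin 3)} (hv : v ∈ fccSlots) (hw : w ∈ fccSlots) (ht : ‖t‖ = 1)
    (htv : 1 / 2 < ⟪t, G v⟫_ℝ) (htw : ⟪t, G w⟫_ℝ = 1 / 2) : 0 ≤ ⟪v, w⟫_ℝ :=
  inner_slots_nonneg_of_inner_gt_ge G hv hw ht htv htw.ge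

/-! ### The two- and three-contact cells (cubic coordinates; first contact the slot `(1,1,0)`) -/

/-- **Two-contact core.**  `Σ xᵢ² = 2`, `x·(1,1,0) = 1` and `x·s_l = 1` for a second slot `s_l ≠ (1,1,0)`: then `x`
is a slot, or `s_l` is ADJACENT to `(1,1,0)` (one of the slots `4, 5, 8, 9`) and `3x = 2((1,1,0) + s_l) − 3 s_c` with `s_c`
the third slot of the triangle of `(1,1,0)` and `s_l` (the face-twin point). -/
theorem two_contacts_core (x : Fin 3 → ℝ) (hn : x 0 ^ 2 + x 1 ^ 2 + x 2 ^ 2 = 2) (l : Fin 12) (hl : l ≠ 0)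
    (h0 : x 0 + x 1 = 1) (h1 : x 0 * slotInt l 0 + x 1 * slotInt l 1 + x 2 * slotInt l 2 = 1) :
    (∃ k : Fin 12, x 0 = slotInt k 0 ∧ x 1 = slotInt k 1 ∧ x 2 = slotInt k 2) ∨
    (∃ c : Fin 12, ((l = 4 ∧ c = 8) ∨ (l = 5 ∧ c = 9) ∨ (l = 8 ∧ c = 4) ∨ (l = 9 ∧ c = 5)) ∧
      ∀ i : Fin 3, 3 * x i = 2 * ((slotInt 0 i : ℝ) + slotInt l i) - 3 * slotInt c i) := by
  fin_cases l
  · exact absurd rfl hl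
  · simp [slotInt] at h1
    have hx0 : x 0 = 1 := by linarith
    have hx1 : x 1 = 0 := by linarith
    have hx2 : (x 2 - 1) * (x 2 + 1) = 0 := by nlinarith
    rcases mul_eq_zero.1 hx2 with h | h
    · exact Or.inl ⟨4, by simp [slotInt]; refine ⟨?_, ?_, ?_⟩ <;> linarith⟩
    · exact Or.inl ⟨5, by simp [slotInt]; refine ⟨?_, ?_, ?_⟩ <;> linarith⟩
  · simp [slotInt] at h1
    have hx0 : x 0 = 0 := by linarith
    have hx1 : x 1 = 1 := by linarith
    have hx2 : (x 2 - 1) * (x 2 + 1) = 0 := by nlinarith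
    rcases mul_eq_zero.1 hx2 with h | h
    · exact Or.inl ⟨8, by simp [slotInt]; refine ⟨?_, ?_, ?_⟩ <;> linarith⟩
    · exact Or.inl ⟨9, by simp [slotInt]; refine ⟨?_, ?_, ?_⟩ <;> linarith⟩
  · simp [slotInt] at h1
    linarith
  · -- l = 4 : (1,0,1) adjacent — x = (0,1,1) or the twin (4,-1,-1)/3, c = (0,1,1) = slot 8
    simp [slotInt] at h1
    have hq : x 0 * (3 * x 0 - 4) = 0 := by nlinarith
    rcases mul_eq_zero.1 hq with h | h
    · exact Or.inl ⟨8, by simp [slotInt]; refine ⟨?_, ?_, ?_⟩ <;> linarith⟩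
    · refine Or.inr ⟨8, by decide, fun i => ?_⟩
      fin_cases i <;> simp [slotInt] <;> linarith
  · -- l = 5 : (1,0,-1) adjacent — x = (0,1,-1) or the twin (4,-1,1)/3, c = (0,1,-1) = slot 9
    simp [slotInt] at h1
    have hq : x 0 * (3 * x 0 - 4) = 0 := by nlinarith
    rcases mul_eq_zero.1 hq with h | h
    · exact Or.inl ⟨9, by simp [slotInt]; refine ⟨?_, ?_, ?_⟩ <;> linarith⟩
    · refine Or.inr ⟨9, by decide, fun i => ?_⟩
      fin_cases i <;> simp [slotInt] <;> linarith
  · simp [slotInt] at h1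
    have hx0 : x 0 = 0 := by nlinarith
    exact Or.inl ⟨8, by simp [slotInt]; refine ⟨?_, ?_, ?_⟩ <;> linarith⟩
  · simp [slotInt] at h1
    have hx0 : x 0 = 0 := by nlinarith
    exact Or.inl ⟨9, by simp [slotInt]; refine ⟨?_, ?_, ?_⟩ <;> linarith⟩
  · -- l = 8 : (0,1,1) adjacent — x = (1,0,1) or the twin (-1,4,-1)/3, c = (1,0,1) = slot 4
    simp [slotInt] at h1
    have hq : x 1 * (3 * x 1 - 4) = 0 := by nlinarith
    rcases mul_eq_zero.1 hq with h | h
    · exact Or.inl ⟨4, by simp [slotInt]; refine ⟨?_, ?_, ?_⟩ <;> linarith⟩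
    · refine Or.inr ⟨4, by decide, fun i => ?_⟩
      fin_cases i <;> simp [slotInt] <;> linarith
  · -- l = 9 : (0,1,-1) adjacent — x = (1,0,-1) or the twin (-1,4,1)/3, c = (1,0,-1) = slot 5
    simp [slotInt] at h1
    have hq : x 1 * (3 * x 1 - 4) = 0 := by nlinarith
    rcases mul_eq_zero.1 hq with h | h
    · exact Or.inl ⟨5, by simp [slotInt]; refine ⟨?_, ?_, ?_⟩ <;> linarith⟩
    · refine Or.inr ⟨5, by decide, fun i => ?_⟩
      fin_cases i <;> simp [slotInt] <;> linarith
  · simp [slotInt] at h1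
    have hx1 : x 1 = 0 := by nlinarith
    exact Or.inl ⟨4, by simp [slotInt]; refine ⟨?_, ?_, ?_⟩ <;> linarith⟩
  · simp [slotInt] at h1
    have hx1 : x 1 = 0 := by nlinarith
    exact Or.inl ⟨5, by simp [slotInt]; refine ⟨?_, ?_, ?_⟩ <;> linarith⟩

/-- The pinned pairs `(l, c)` of `two_contacts_core` are the (second vertex, apex) pairs of the four slot triangles at
`(1,1,0)`. -/
theorem faceTwin_pin_adjacent (l c : Fin 12) (h : (l = 4 ∧ c = 8) ∨ (l = 5 ∧ c = 9) ∨ (l = 8 ∧ c = 4) ∨ (l = 9 ∧ c = 5)) :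
    slotInt l ⬝ᵥ slotInt 0 = 1 ∧ slotInt c ⬝ᵥ slotInt 0 = 1 ∧ slotInt c ⬝ᵥ slotInt l = 1 := by
  rcases h with ⟨rfl, rfl⟩ | ⟨rfl, rfl⟩ | ⟨rfl, rfl⟩ | ⟨rfl, rfl⟩ <;> decide

/-- **Three-contact core.**  `Σ xᵢ² = 2` and `x·s = 1` for `(1,1,0)` and two further distinct slots: `x` is a slot.
(A face-twin point has exactly two contact slots.) -/
theorem three_contacts_core (x : Fin 3 → ℝ) (hn : x 0 ^ 2 + x 1 ^ 2 + x 2 ^ 2 = 2) (l l' : Fin 12) (hl : l ≠ 0)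
    (hl' : l' ≠ 0) (hll' : l' ≠ l) (h0 : x 0 + x 1 = 1)
    (h1 : x 0 * slotInt l 0 + x 1 * slotInt l 1 + x 2 * slotInt l 2 = 1)
    (h2 : x 0 * slotInt l' 0 + x 1 * slotInt l' 1 + x 2 * slotInt l' 2 = 1) :
    ∃ k : Fin 12, x 0 = slotInt k 0 ∧ x 1 = slotInt k 1 ∧ x 2 = slotInt k 2 := by
  rcases two_contacts_core x hn l hl h0 h1 with h | ⟨c, hpin, hx⟩
  · exact h
  have e0 := hx 0
  have e1 := hx 1
  have e2 := hx 2
  exfalso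
  rcases hpin with ⟨rfl, rfl⟩ | ⟨rfl, rfl⟩ | ⟨rfl, rfl⟩ | ⟨rfl, rfl⟩ <;>
    simp [slotInt] at e0 e1 e2 <;>
    fin_cases l' <;>
    first | exact absurd rfl hl' | exact absurd rfl hll' | (simp [slotInt] at h2; linarith)

/-! ### Cubic-coordinate bookkeeping for a unit vector -/

section Cubic

variable (Y : EuclideanSpace ℝ (Fin 3))

/-- `Σ (√2 cᵢ)² = 2` for a unit vector. -/
theorem cubic_two_norm (hY : ‖Y‖ = 1) :
    (Real.sqrt 2 * cubicCoords Y 0) ^ 2 + (Real.sqrt 2 * cubicCoords Y 1) ^ 2 + (Real.sqrt 2 * cubicCoords Y 2) ^ 2 = 2 := by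
  have h := norm_sq_eq_cubicCoords_sum Y
  rw [hY] at h
  have h2 : Real.sqrt 2 ^ 2 = 2 := Real.sq_sqrt (by norm_num)
  simp only [mul_pow, h2]
  nlinarith [h]

/-- A contact slot in cubic coordinates: `⟪Y, slot k⟫ = ½ ↔ (√2 c)·s_k = 1`. -/
theorem cubic_contact_iff (k : Fin 12) :
    ⟪Y, slotSite k⟫_ℝ = 1 / 2 ↔
      Real.sqrt 2 * cubicCoords Y 0 * slotInt k 0 + Real.sqrt 2 * cubicCoords Y 1 * slotInt k 1 +
        Real.sqrt 2 * cubicCoords Y 2 * slotInt k 2 = 1 := by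
  have h2 : Real.sqrt 2 ^ 2 = 2 := Real.sq_sqrt (by norm_num)
  have h2pos : 0 < Real.sqrt 2 := Real.sqrt_pos.2 (by norm_num)
  rw [inner_slotSite_right, div_eq_iff h2pos.ne']
  constructor
  · intro h
    linear_combination Real.sqrt 2 * h + (1 / 2 : ℝ) * h2
  · intro h
    linear_combination (Real.sqrt 2 / 2) * h -
      (1 / 2 : ℝ) * (cubicCoords Y 0 * slotInt k 0 + cubicCoords Y 1 * slotInt k 1 + cubicCoords Y 2 * slotInt k 2) * h2

/-- A unit vector whose scaled cubic coordinates are a slot triple is that slot. -/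
theorem eq_slotSite_of_cubic (k : Fin 12) (h0 : Real.sqrt 2 * cubicCoords Y 0 = slotInt k 0)
    (h1 : Real.sqrt 2 * cubicCoords Y 1 = slotInt k 1) (h2 : Real.sqrt 2 * cubicCoords Y 2 = slotInt k 2) :
    Y = slotSite k := by
  have h2pos : 0 < Real.sqrt 2 := Real.sqrt_pos.2 (by norm_num)
  apply cubicCoords_injective
  rw [cubicCoords_slotSite]
  ext i
  simp only [slotVec]
  rw [eq_div_iff h2pos.ne']
  fin_cases i
  · simpa [mul_comm] using h0
  · simpa [mul_comm] using h1
  · simpa [mul_comm] using h2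

/-- A vector whose scaled cubic coordinates are `(2(s₀ + s_l) − 3 s_c)/3` is the face-twin vector `⅔(s₀ + s_l) − s_c`. -/
theorem eq_faceTwin_of_cubic (l c : Fin 12)
    (h : ∀ i : Fin 3, 3 * (Real.sqrt 2 * cubicCoords Y i) = 2 * ((slotInt 0 i : ℝ) + slotInt l i) - 3 * slotInt c i) :
    Y = (2 / 3 : ℝ) • (slotSite 0 + slotSite l) - slotSite c := by
  have h2pos : 0 < Real.sqrt 2 := Real.sqrt_pos.2 (by norm_num)
  apply cubicCoords_injective
  rw [cubicCoords_sub, cubicCoords_smul, cubicCoords_add, cubicCoords_slotSite, cubicCoords_slotSite, cubicCoords_slotSite]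
  ext i
  simp only [Pi.sub_apply, Pi.smul_apply, Pi.add_apply, slotVec, smul_eq_mul]
  have hi := h i
  field_simp
  nlinarith [hi, h2pos]

end Cubic

/-! ### The two- and three-contact theorems for a frame -/

/-- **Two contact slots: on the frame or at a face twin.**  For a frame `G`, a unit `t` and two distinct slots
`a ≠ b` with `⟪t, G a⟫ = ⟪t, G b⟫ = ½`: either `t = G w` for a slot `w`, or `a, b` are adjacent and, with `c` the
third slot of their triangle, `t = G (⅔(a + b) − c)`. -/
theorem eq_frame_or_faceTwin_of_two_contacts (G : EuclideanSpace ℝ (Fin 3) ≃ₗᵢ[ℝ] EuclideanSpace ℝ (Fin 3))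
    {t : EuclideanSpace ℝ (Fin 3)} (ht : ‖t‖ = 1) {a b : EuclideanSpace ℝ (Fin 3)} (ha : a ∈ fccSlots)
    (hb : b ∈ fccSlots) (hab : a ≠ b) (hta : ⟪t, G a⟫_ℝ = 1 / 2) (htb : ⟪t, G b⟫_ℝ = 1 / 2) :
    (∃ w ∈ fccSlots, t = G w) ∨
    (⟪a, b⟫_ℝ = 1 / 2 ∧ ∃ c ∈ fccSlots, ⟪c, a⟫_ℝ = 1 / 2 ∧ ⟪c, b⟫_ℝ = 1 / 2 ∧
      t = G ((2 / 3 : ℝ) • (a + b) - c)) := by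
  obtain ⟨g, hg, hg', hga⟩ := exists_latticeIso_map_slot (slotSite_mem 0) ha
  obtain ⟨l, hl⟩ := exists_slotSite_eq (map_mem_fccSlots g.symm hg' hb)
  have hgl : g (slotSite l) = b := by rw [hl]; simp
  have hl0 : l ≠ 0 := fun h => hab (by rw [← hga, ← hgl, h])
  set Y : EuclideanSpace ℝ (Fin 3) := g.symm (G.symm t) with hY
  have htY : t = G (g Y) := by rw [hY]; simp
  have hYn : ‖Y‖ = 1 := by rw [hY, LinearIsometryEquiv.norm_map, LinearIsometryEquiv.norm_map, ht]
  have hin : ∀ k : Fin 12, ⟪t, G (g (slotSite k))⟫_ℝ = ⟪Y, slotSite k⟫_ℝ := by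
    intro k; rw [htY, LinearIsometryEquiv.inner_map_map, LinearIsometryEquiv.inner_map_map]
  set x : Fin 3 → ℝ := fun i => Real.sqrt 2 * cubicCoords Y i with hx
  have hn : x 0 ^ 2 + x 1 ^ 2 + x 2 ^ 2 = 2 := cubic_two_norm Y hYn
  have h0 : x 0 + x 1 = 1 := by
    have := (cubic_contact_iff Y 0).1 (by rw [← hin, hga]; exact hta)
    simp only [slotInt, Fin.isValue, Matrix.cons_val_zero, Matrix.cons_val_one, Matrix.cons_val] at this
    norm_num at this
    simp only [hx]; linarith
  have h1 : x 0 * slotInt l 0 + x 1 * slotInt l 1 + x 2 * slotInt l 2 = 1 :=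
    (cubic_contact_iff Y l).1 (by rw [← hin, hgl]; exact htb)
  rcases two_contacts_core x hn l hl0 h0 h1 with ⟨k, hk0, hk1, hk2⟩ | ⟨c, hpin, hxc⟩
  · left
    have hYk : Y = slotSite k := eq_slotSite_of_cubic Y k hk0 hk1 hk2
    exact ⟨g (slotSite k), map_mem_fccSlots g hg (slotSite_mem k), by rw [htY, hYk]⟩
  · right
    obtain ⟨hl0', hc0, hcl⟩ := faceTwin_pin_adjacent l c hpin
    have hYeq : Y = (2 / 3 : ℝ) • (slotSite 0 + slotSite l) - slotSite c := eq_faceTwin_of_cubic Y l c hxc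
    have hab' : ⟪a, b⟫_ℝ = 1 / 2 := by
      rw [← hga, ← hgl, LinearIsometryEquiv.inner_map_map, real_inner_comm, inner_slotSite, hl0']; norm_num
    refine ⟨hab', g (slotSite c), map_mem_fccSlots g hg (slotSite_mem c), ?_, ?_, ?_⟩
    · rw [← hga, LinearIsometryEquiv.inner_map_map, inner_slotSite, hc0]; norm_num
    · rw [← hgl, LinearIsometryEquiv.inner_map_map, inner_slotSite, hcl]; norm_num
    · rw [htY, hYeq, ← hga, ← hgl, map_sub, map_smul, map_add]

/-- **Three contact slots force the frame.**  If a unit `t` has `⟪t, G w⟫ = ½` for three distinct slots, then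
`t = G w` for a slot `w`. -/
theorem eq_frame_of_three_contacts (G : EuclideanSpace ℝ (Fin 3) ≃ₗᵢ[ℝ] EuclideanSpace ℝ (Fin 3))
    {t : EuclideanSpace ℝ (Fin 3)} (ht : ‖t‖ = 1) {a b b' : EuclideanSpace ℝ (Fin 3)} (ha : a ∈ fccSlots)
    (hb : b ∈ fccSlots) (hb' : b' ∈ fccSlots) (hab : a ≠ b) (hab' : a ≠ b') (hbb' : b ≠ b')
    (hta : ⟪t, G a⟫_ℝ = 1 / 2) (htb : ⟪t, G b⟫_ℝ = 1 / 2) (htb' : ⟪t, G b'⟫_ℝ = 1 / 2) :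
    ∃ w ∈ fccSlots, t = G w := by
  obtain ⟨g, hg, hg', hga⟩ := exists_latticeIso_map_slot (slotSite_mem 0) ha
  obtain ⟨l, hl⟩ := exists_slotSite_eq (map_mem_fccSlots g.symm hg' hb)
  obtain ⟨l', hl'⟩ := exists_slotSite_eq (map_mem_fccSlots g.symm hg' hb')
  have hgl : g (slotSite l) = b := by rw [hl]; simp
  have hgl' : g (slotSite l') = b' := by rw [hl']; simp
  have hl0 : l ≠ 0 := fun h => hab (by rw [← hga, ← hgl, h])
  have hl'0 : l' ≠ 0 := fun h => hab' (by rw [← hga, ← hgl', h])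
  have hll' : l' ≠ l := fun h => hbb' (by rw [← hgl, ← hgl', h])
  set Y : EuclideanSpace ℝ (Fin 3) := g.symm (G.symm t) with hY
  have htY : t = G (g Y) := by rw [hY]; simp
  have hYn : ‖Y‖ = 1 := by rw [hY, LinearIsometryEquiv.norm_map, LinearIsometryEquiv.norm_map, ht]
  have hin : ∀ k : Fin 12, ⟪t, G (g (slotSite k))⟫_ℝ = ⟪Y, slotSite k⟫_ℝ := by
    intro k; rw [htY, LinearIsometryEquiv.inner_map_map, LinearIsometryEquiv.inner_map_map]
  set x : Fin 3 → ℝ := fun i => Real.sqrt 2 * cubicCoords Y i with hx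
  have hn : x 0 ^ 2 + x 1 ^ 2 + x 2 ^ 2 = 2 := cubic_two_norm Y hYn
  have h0 : x 0 + x 1 = 1 := by
    have := (cubic_contact_iff Y 0).1 (by rw [← hin, hga]; exact hta)
    simp only [slotInt, Fin.isValue, Matrix.cons_val_zero, Matrix.cons_val_one, Matrix.cons_val] at this
    norm_num at this
    simp only [hx]; linarith
  have h1 : x 0 * slotInt l 0 + x 1 * slotInt l 1 + x 2 * slotInt l 2 = 1 :=
    (cubic_contact_iff Y l).1 (by rw [← hin, hgl]; exact htb)
  have h2 : x 0 * slotInt l' 0 + x 1 * slotInt l' 1 + x 2 * slotInt l' 2 = 1 :=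
    (cubic_contact_iff Y l').1 (by rw [← hin, hgl']; exact htb')
  obtain ⟨k, hk0, hk1, hk2⟩ := three_contacts_core x hn l l' hl0 hl'0 hll' h0 h1 h2
  have hYk : Y = slotSite k := eq_slotSite_of_cubic Y k hk0 hk1 hk2
  exact ⟨g (slotSite k), map_mem_fccSlots g hg (slotSite_mem k), by rw [htY, hYk]⟩

open scoped Classical in
/-- **An off-frame unit vector has at most two contact slots.** -/
theorem card_contactSlots_le_two (G : EuclideanSpace ℝ (Fin 3) ≃ₗᵢ[ℝ] EuclideanSpace ℝ (Fin 3))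
    {t : EuclideanSpace ℝ (Fin 3)} (ht : ‖t‖ = 1) (hoff : ∀ w ∈ fccSlots, t ≠ G w) :
    (fccSlots.filter fun w => ⟪t, G w⟫_ℝ = 1 / 2).card ≤ 2 := by
  by_contra hlt
  push Not at hlt
  obtain ⟨a, ha, b, hb, b', hb', hab, hab', hbb'⟩ := Finset.two_lt_card.1 hlt
  rw [mem_filter] at ha hb hb'
  obtain ⟨w, hw, htw⟩ := eq_frame_of_three_contacts G ht ha.1 hb.1 hb'.1 hab hab' hbb' ha.2 hb.2 hb'.2
  exact hoff w hw htw

/-- At a face-twin position the two slots `a − c`, `b − c` are strictly blocked: `⟪⅔(a + b) − c, a − c⟫ = 5/6`. -/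
theorem inner_faceTwin_sub {a b c : EuclideanSpace ℝ (Fin 3)} (ha : a ∈ fccSlots) (hc : c ∈ fccSlots)
    (hab : ⟪a, b⟫_ℝ = 1 / 2) (hca : ⟪c, a⟫_ℝ = 1 / 2) (hcb : ⟪c, b⟫_ℝ = 1 / 2) :
    ⟪(2 / 3 : ℝ) • (a + b) - c, a - c⟫_ℝ = 5 / 6 := by
  have h11 : ⟪a, a⟫_ℝ = 1 := by rw [real_inner_self_eq_norm_sq, norm_eq_one_of_mem_fccSlots ha, one_pow]
  have h33 : ⟪c, c⟫_ℝ = 1 := by rw [real_inner_self_eq_norm_sq, norm_eq_one_of_mem_fccSlots hc, one_pow]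
  have hba : ⟪b, a⟫_ℝ = 1 / 2 := by rw [real_inner_comm]; exact hab
  have hac : ⟪a, c⟫_ℝ = 1 / 2 := by rw [real_inner_comm]; exact hca
  have hbc : ⟪b, c⟫_ℝ = 1 / 2 := by rw [real_inner_comm]; exact hcb
  simp only [inner_sub_left, inner_sub_right, inner_smul_left, inner_add_left, h11, h33, hba, hac, hbc, hca,
    RCLike.conj_to_real]
  norm_num

/-! ### Configuration level -/

/-- A ball `x` touching `y` touches the frame ball `y + G w` iff `⟪x − y, G w⟫ = ½`. -/
theorem dist_frame_eq_one_iff (G : EuclideanSpace ℝ (Fin 3) ≃ₗᵢ[ℝ] EuclideanSpace ℝ (Fin 3))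
    {x y w : EuclideanSpace ℝ (Fin 3)} (hxy : dist x y = 1) (hw : w ∈ fccSlots) :
    dist x (y + G w) = 1 ↔ ⟪x - y, G w⟫_ℝ = 1 / 2 := by
  have ht : ‖x - y‖ = 1 := by rwa [← dist_eq_norm]
  have hGw : ‖G w‖ = 1 := by rw [LinearIsometryEquiv.norm_map, norm_eq_one_of_mem_fccSlots hw]
  have hd : dist x (y + G w) = ‖x - y - G w‖ := by rw [dist_eq_norm]; congr 1; abel
  have hsq : ‖x - y - G w‖ ^ 2 = 2 - 2 * ⟪x - y, G w⟫_ℝ := by rw [norm_sub_sq_real, ht, hGw]; ring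
  rw [hd]
  constructor
  · intro h; rw [h] at hsq; linarith
  · intro h
    rw [h] at hsq
    have h1 : ‖x - y - G w‖ ^ 2 = 1 ^ 2 := by rw [hsq]; norm_num
    exact (sq_eq_sq₀ (norm_nonneg _) zero_le_one).1 h1

open scoped Classical in
/-- **A foreign contact touches at most two frame balls of its host.**  If `x` touches `y` (`dist x y = 1`) off the
frame `y + G·fccSlots`, at most two of the twelve frame positions `y + G w` are at distance `1` from `x`. -/
theorem foreign_contact_frame_contacts_le_two (G : EuclideanSpace ℝ (Fin 3) ≃ₗᵢ[ℝ] EuclideanSpace ℝ (Fin 3))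
    {x y : EuclideanSpace ℝ (Fin 3)} (hxy : dist x y = 1) (hoff : ∀ w ∈ fccSlots, x ≠ y + G w) :
    (fccSlots.filter fun w => dist x (y + G w) = 1).card ≤ 2 := by
  have ht : ‖x - y‖ = 1 := by rwa [← dist_eq_norm]
  have hoff' : ∀ w ∈ fccSlots, x - y ≠ G w := fun w hw h => hoff w hw (by rw [← h]; abel)
  have heq : (fccSlots.filter fun w => dist x (y + G w) = 1) = fccSlots.filter fun w => ⟪x - y, G w⟫_ℝ = 1 / 2 :=
    filter_congr fun w hw => dist_frame_eq_one_iff G hxy hw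
  rw [heq]
  exact card_contactSlots_le_two G ht hoff'

/-- **Two frame contacts: the face twin, with its blocked pair vacant.**  In a `1`-separated `X`, if `x ∈ X` touches
`y` off the frame and touches two frame positions `y + G a ≠ y + G b`, then `a, b` are adjacent, `x = y + G(⅔(a + b) − c)`
with `c` the third slot of their triangle, and the two sites `y + G (a − c)`, `y + G (b − c)` are vacant. -/
theorem foreign_contact_faceTwin {X : Finset (EuclideanSpace ℝ (Fin 3))}
    (hX : ∀ p ∈ X, ∀ q ∈ X, p ≠ q → 1 ≤ dist p q)
    (G : EuclideanSpace ℝ (Fin 3) ≃ₗᵢ[ℝ] EuclideanSpace ℝ (Fin 3)) {y x : EuclideanSpace ℝ (Fin 3)} (hx : x ∈ X)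
    (hxy : dist x y = 1) (hoff : ∀ w ∈ fccSlots, x ≠ y + G w) {a b : EuclideanSpace ℝ (Fin 3)} (ha : a ∈ fccSlots)
    (hb : b ∈ fccSlots) (hab : a ≠ b) (hxa : dist x (y + G a) = 1) (hxb : dist x (y + G b) = 1) :
    ⟪a, b⟫_ℝ = 1 / 2 ∧ ∃ c ∈ fccSlots, ⟪c, a⟫_ℝ = 1 / 2 ∧ ⟪c, b⟫_ℝ = 1 / 2 ∧
      x = y + G ((2 / 3 : ℝ) • (a + b) - c) ∧ y + G (a - c) ∉ X ∧ y + G (b - c) ∉ X := by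
  have ht : ‖x - y‖ = 1 := by rwa [← dist_eq_norm]
  have hoff' : ∀ w ∈ fccSlots, x - y ≠ G w := fun w hw h => hoff w hw (by rw [← h]; abel)
  rcases eq_frame_or_faceTwin_of_two_contacts G ht ha hb hab ((dist_frame_eq_one_iff G hxy ha).1 hxa)
      ((dist_frame_eq_one_iff G hxy hb).1 hxb) with ⟨w, hw, htw⟩ | ⟨hab', c, hc, hca, hcb, htc⟩
  · exact absurd htw (hoff' w hw)
  have hxeq : x = y + G ((2 / 3 : ℝ) • (a + b) - c) := by rw [← htc]; abel
  have hba : ⟪b, a⟫_ℝ = 1 / 2 := by rw [real_inner_comm]; exact hab'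
  have hac : a - c ∈ fccSlots := sub_mem_fccSlots_of_inner_eq_half ha hc (by rw [real_inner_comm]; exact hca)
  have hbc : b - c ∈ fccSlots := sub_mem_fccSlots_of_inner_eq_half hb hc (by rw [real_inner_comm]; exact hcb)
  have hblock_a : 1 / 2 < ⟪x - y, G (a - c)⟫_ℝ := by
    rw [htc, LinearIsometryEquiv.inner_map_map, inner_faceTwin_sub ha hc hab' hca hcb]; norm_num
  have hblock_b : 1 / 2 < ⟪x - y, G (b - c)⟫_ℝ := by
    rw [htc, LinearIsometryEquiv.inner_map_map, show (2 / 3 : ℝ) • (a + b) - c = (2 / 3 : ℝ) • (b + a) - c by rw [add_comm],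
      inner_faceTwin_sub hb hc hba hcb hca]; norm_num
  exact ⟨hab', c, hc, hca, hcb, hxeq, vacant_of_blocked hX G hx hxy hac (hoff _ hac) hblock_a,
    vacant_of_blocked hX G hx hxy hbc (hoff _ hbc) hblock_b⟩

end Summit.Ventures.Crystal3D.Theorems

end
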